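import Summits.ABC.IUTFork.Repair.RHLabelCutJ3
import Summits.ABC.IUTFork.Cor312ProvKRamifiedLabel
import Summits.ABC.IUTFork.Cor312GenuineKDeepDatumLam
import Summits.ABC.IUTFork.Conditional.AbcOfSGenuineKChosenDepthHexSharpLocalType
import HarnessLib

/-!
# R-H ROUND 1 (D-0107), pair n = 9 — `RHLabelCutJ3Kill`: the THEOREM-GRADE KILL of H⋆₉ «label-cut-j3» on the HEX family of record —
# at the genuine `λ_k = 1/2 + 2/7^k` datum, `¬ HStar` past an explicit integer threshold in `(k, l)`, MODEL-FREE

PROOF-ONLY file (0 definitions, 0 `Prop` facts, no instance, no notation) of the abc-iut cell, D-0079 RESCUE sub-cell R-H («local-height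
condition I06⋆»), rung LADDER-ABC:A2.RESCUE.H; seat abc-iut-rh-typ-9 gen 2 (R-H ROUND 1 PAIR n = 9 TYPER; row 9 of
`plan/rescue/R-H/RH-CANDIDATES.tsv`, one writer abc-iut-rh-lead g0; verdict of record `ROUND1.tsv` row 9 = KILL(k1), FINAL 17:45Z, on
abc-iut-rh-typ-9 gen 0's p459152 `RHLabelCutJ3` + abc-iut-rh-num-1's two-engine k1: lamSeven 16/256 = the `k = 1` groups). TAKES NO SIDE on
[IUTchIII] Cor. 3.12 or on any author. H⋆₉ is a CANDIDATE HYPOTHESIS (claim-tagged `def HStar`, p459152), never a Literature fact; «refuted as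
typed at OUR genuine datum» ≠ «refuted in print»; typed ≠ proved; nothing here asserts abc.

WHY. `plan/rescue/R-H/START-HERE.md` §3: «a KILL needs a NAMED row+cell or a NAMED theorem»; §7: «a KILLED H⋆ with a theorem-grade kill is
knowledge and is listed with its killer». Row 9's k1 = FAIL is of record BY NUMBER (HEX-lamSeven 16/256, pooled 908/2570); this file makes the
kill a KERNEL THEOREM on the genuine HEX family of record (same binder shape as abc-iut-rh-typ-10's `RHSharpUpperEdge.not_hStar_lamSeven`,
p460832, and abc-iut-rp-d2's `CandInternal2RealHex.i06star_topLabel_false_lamSeven`, p456127), through ROW 9'S OWN integer NEG door at the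
label `j = 3` (`RH.LabelCutJ3.not_hStar_of_negDoor`, p459152) — so the thresholds are those of the label `3`, not of the top label.

HOW (composition of landed bricks, no new number theory). At the genuine datum `T : ThetaVolumeDatumAt (ratPoint λ_k) l` (`k ≥ 1`, `l` prime
`≥ 11`): abc-iut-c312-7's `Conditional.GenuineK.exists_place_lamSeven` gives a BAD place `x₀ | 7` of `T.K` at which the CHOSEN realising q-idele
has `‖t_q(x₀)‖ = 7^{−k/l}`; `Cor312Prov.exists_nat_qPilot_pilotDataOfK` gives `P_{x₀} = P ∈ ℕ` and `RH.LabelCutJ3.norm_tq_eq_rpow`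
(`‖t_q(x₀)‖ = 7^{−P/e}`, `e = e(K_{x₀}/ℚ_7)`) gives `P·l = k·e`; abc-iut-w5-d163's LOCAL TYPE `Conditional.GenuineK.absRamificationIdx_kOf_dvd_sixty_mul`
(`e ∣ 60·l`, from abc-iut-W-neg-1's `Cor22.ramificationIdx_subThetaField_dvd_sixty` and [IUTchIV] Prop. 1.8 (vii)) bounds `e ≤ 60·l`, so
`b_e = ⌊log_7(e/6)⌋ ≤ ⌊log_7(10·l)⌋ =: B(l)`; and `Cor312Prov.l_le_absRamificationIdx_kOf_pilotDataOfK` gives `e ≥ l ≥ 11 > 6` (the NEG door's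
row range `e ≥ p − 1`). The integer trigger `l·(B + 2) ≤ 8·k` then yields ROW 9'S NEG DOOR `NegDoor 7 e P 3`
(`e·(b_e + 2) + P ≤ 9·P`, §1 `negDoor_three_of_trigger`), and `not_hStar_of_negDoor` (label `3 ∈ 𝔽_l^⋇` as `l ≥ 7`) refutes `HStar` for EVERY
realising q-idele (§2 `not_hStar_lamSeven_of_realises`), in particular the chosen one (`not_hStar_lamSeven`).

RESULTS (namespace `Summit.ABC.IUTFork.Repair.RH.LabelCutJ3`, continued):
* §1 `negDoor_three_of_trigger` (`⌊log_7(e/6)⌋ ≤ B`, `l·(B+2) ≤ 8k`, `P·l = k·e` ⟹ `NegDoor 7 e P 3`); `natLog_div_six_le_of_le_sixty_mul`.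
* §2 **`not_hStar_lamSeven_of_realises`** / **`not_hStar_lamSeven`** (MODEL-FREE): `k ≥ 1`, `l` prime `≥ 11`, `⌊log_7(10·l)⌋ ≤ B`,
  `l·(B + 2) ≤ 8·k` ⟹ `¬ HStar T.D t_q` for every realising q-idele `t_q` of EVERY genuine Θ-volume datum `T` at `(ratPoint λ_k, l)`.
* §3 numeric rows: **`not_hStar_lamSeven_l11`** (`l = 11`: every `k ≥ 6`), **`not_hStar_lamSeven_l13`** (`l = 13`: every `k ≥ 7`), and the
  uniform strip **`not_hStar_lamSeven_of_le_34`** (every prime `11 ≤ l ≤ 34`: every `k` with `l ≤ 2k`; `B = 2` since `10·l < 7³`).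
* §4 `not_hStar_of_ramification_le_fortyone` — per fibre point with a SUPPLIED small ramification `e(K_{x₀}/ℚ_7) ≤ 41` (the table's lamSeven
  rows with `e_w = l`, i.e. `e(v|7) = 1`; a HYPOTHESIS on the place, never asserted): `b_e = 0`, trigger `l ≤ 4k` — `k ≥ 3` at `l = 11`,
  `k ≥ 4` at `l = 13`, matching p459152's `k1_hex_large_k` cells `NegDoor 7 11 3 3`-type rows and `¬ NegDoor 7 13 3 3`.
READING (neutral, for `ROUND1.tsv` row 9): the KILL(k1) of record is THEOREM-GRADE on the lamSeven family at `l = 11, k ≥ 6` and `l = 13, k ≥ 7`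
(model-free), resp. `k ≥ 3` / `k ≥ 4` at places with `e_w ≤ 41`; the number of record 16/256 (the `k = 1` groups POS, `k ≥ 2` OPEN/NEG) stands
for the rest. Since full real I06⋆ ⟹ H⋆₉ (`hStar_of_realStar`), each `¬ H⋆₉` here is also a `¬ I06⋆` at the same datum (not restated).
[cite: Mochizuki2012, IUTchI Def. 3.1 (b),(c) pp. 61–62, Ex. 3.2 (iv) p. 71; IUTchIV Prop. 1.2 (i) p. 10, Prop. 1.8 (vi)–(vii) p. 19,
Cor. 2.2 (ii) proof (P5) p. 46] [cite: MochizukiAbsTopIII2015, Def 5.4 (iii) p. 126] [cite: NeukirchANT1999, Ch. II (5.5)]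
[cite: DupuyHilado2025, §3.4] [claim: Mochizuki2012, status: disputed] for every IUT sentence quoted. Axioms: standard.
-/

noncomputable section

open Set Metric Function NumberField IsDedekindDomain
open scoped Pointwise

namespace Summit.ABC.IUTFork.Repair.RH.LabelCutJ3

open Literature.AnabelianGeometry.AbsoluteAnabelian Literature.IUT.LogThetaLattice Literature.IUT.LogVolume
  Literature.IUT.HodgeTheaters Literature.NumberTheory.NumberFields Literature.NumberTheory.GaloisRepresentations.Ultrametric
  Literature.NumberTheory.DiophantineGeometry.GenEll Literature.NumberTheory.DiophantineGeometry
open Summit.ABC.IUTFork.Thm311 Summit.ABC.IUTFork.Thm311.Real Summit.ABC.IUTFork.Cor312 Summit.ABC.IUTFork.Cor312.Setting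
  Summit.ABC.IUTFork.Cor312Vol Summit.ABC.IUTFork.Cor312Prov Summit.ABC.IUTFork.Conditional
  Summit.ABC.IUTFork.Repair.CandInternal2Real Summit.ABC.IUTFork.Repair.CandInternal2RealLabels

/-! ## §1. Integer arithmetic: the trigger gives row 9's NEG door at the label `3` over `ℚ_7` -/

/-- **ROW 9's NEG DOOR FROM THE INTEGER TRIGGER** (over `ℚ_7`, label `j = 3`): if `⌊log_7(e/6)⌋ ≤ B`, `l·(B + 2) ≤ 8·k`, `l ≥ 1` and the pilot
degree satisfies `P·l = k·e` (`P/e = k/l`), then `NegDoor 7 e P 3`, i.e. `e·(b_e + 2) + P ≤ 9·P` (`e·(⌊log_7(e/6)⌋ + 2) ≤ e·(B+2)`, and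
`l·e·(B+2) ≤ 8k·e = 8·P·l`). [folklore] -/
theorem negDoor_three_of_trigger {e P k l B : ℕ} (hl : 1 ≤ l) (hB : Nat.log 7 (e / 6) ≤ B) (hkB : l * (B + 2) ≤ 8 * k)
    (hPl : P * l = k * e) : NegDoor 7 e P 3 := by
  unfold NegDoor
  show e * (Nat.log 7 (e / 6) + 2) + P ≤ 3 ^ 2 * P
  have h1 : e * (Nat.log 7 (e / 6) + 2) ≤ e * (B + 2) := Nat.mul_le_mul_left e (by omega)
  have h2 : l * (e * (B + 2)) ≤ l * (8 * P) := by
    calc l * (e * (B + 2)) = e * (l * (B + 2)) := by ring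
      _ ≤ e * (8 * k) := Nat.mul_le_mul_left e hkB
      _ = 8 * (k * e) := by ring
      _ = 8 * (P * l) := by rw [hPl]
      _ = l * (8 * P) := by ring
  have h3 : e * (B + 2) ≤ 8 * P := Nat.le_of_mul_le_mul_left h2 hl
  have h9 : 3 ^ 2 * P = 9 * P := by norm_num
  omega

/-- `e ≤ 60·l` ⟹ `⌊log_7(e/6)⌋ ≤ ⌊log_7(10·l)⌋` (the local type `e ∣ 60·l` feeds the door through this monotone bound). [folklore] -/
theorem natLog_div_six_le_of_le_sixty_mul {e l : ℕ} (he : e ≤ 60 * l) : Nat.log 7 (e / 6) ≤ Nat.log 7 (10 * l) :=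
  Nat.log_mono_right (by omega)

/-- `⌊log_7(10·l)⌋ ≤ 2` for `l ≤ 34` (`10·34 = 340 < 343 = 7³`). [folklore] -/
theorem natLog_ten_mul_le_two {l : ℕ} (hl : l ≤ 34) : Nat.log 7 (10 * l) ≤ 2 := by
  rcases Nat.eq_zero_or_pos l with rfl | hl0
  · simp
  · have h3 : 10 * l < 7 ^ 3 := by norm_num; omega
    have h : Nat.log 7 (10 * l) < 3 := Nat.log_lt_of_lt_pow (by omega) h3
    omega

/-! ## §2. At the genuine `λ_k` datum of record: `¬ H⋆₉`, model-free -/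

/-- **THEOREM-GRADE KILL OF H⋆₉ ON THE HEX FAMILY, FOR EVERY REALISING q-IDELE (MODEL-FREE).** `k ≥ 1`, `l` prime `≥ 11`, an integer
`B ≥ ⌊log_7(10·l)⌋` with `l·(B + 2) ≤ 8·k`. Then for EVERY genuine Θ-volume datum `T` at `(ratPoint λ_k, l)`, `λ_k = 1/2 + 2/7^k`, and every
q-idele `t_q` REALISING the q-pilot divisor of `pilotDataOfK T.D T.K` (abc-iut-w5-d236's binder), the candidate H⋆₉ «label-cut-j3» FAILS:
`¬ HStar T.D t_q` — witnessed at the bad place `x₀ | 7` of abc-iut-c312-7's `GenuineK.exists_place_lamSeven` and the label `j = 3`, through row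
9's NEG door (`e·(b_e + 2) + P ≤ 9·P` with `P·l = k·e`, `l ≤ e ∣ 60·l`). [cite: Mochizuki2012, IUTchI Def. 3.1 (b),(c) pp. 61–62, Ex. 3.2 (iv)
p. 71; IUTchIV Prop. 1.2 (i) p. 10, Prop. 1.8 (vii) p. 19, Cor. 2.2 (ii) proof (P5) p. 46] [cite: MochizukiAbsTopIII2015, Def 5.4 (iii) p. 126]
[cite: DupuyHilado2025, §3.4] [claim: Mochizuki2012, status: disputed] -/
theorem not_hStar_lamSeven_of_realises {k l B : ℕ} (hk : 1 ≤ k) (hl : l.Prime) (h11 : 11 ≤ l)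
    (hB : Nat.log 7 (10 * l) ≤ B) (hkB : l * (B + 2) ≤ 8 * k)
    (T : Cor22.ThetaVolumeDatumAt (ratPoint ((2 : ℚ)⁻¹ + 2 / 7 ^ k)) l) :
    letI := T.instFieldF; letI := T.instNumberFieldF; letI := T.instAlgebraF; letI := T.instFieldK
    letI := T.instNumberFieldK; letI := T.instAlgebraK; letI := T.instFieldFbar; letI := T.instAlgebraFbar
    letI := T.instAlgebraKFbar; letI := T.instIsElliptic
    ∀ (tq : ∀ (pp : Nat.Primes) (x : (thetaIndex (pilotDataOfK T.D T.K)).Fibre (.inr pp)),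
        haveI : Fact (pp : ℕ).Prime := ⟨pp.2⟩; kOf (pilotDataOfK T.D T.K) pp.1 x),
      (∀ pp x, tq pp x ≠ 0) →
      (∀ (pp : Nat.Primes) (x : (thetaIndex (pilotDataOfK T.D T.K)).Fibre (.inr pp)),
        haveI : Fact (pp : ℕ).Prime := ⟨pp.2⟩
        Real.log ‖tq pp x‖ = -((pilotDataOfK T.D T.K).qPilot (placeOf (pilotDataOfK T.D T.K) pp.1 x)) *
          logNorm T.K (placeOf (pilotDataOfK T.D T.K) pp.1 x) / localDegree T.K (placeOf (pilotDataOfK T.D T.K) pp.1 x)) →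
      ¬ HStar T.D tq := by
  letI := T.instFieldF; letI := T.instNumberFieldF; letI := T.instAlgebraF; letI := T.instFieldK
  letI := T.instNumberFieldK; letI := T.instAlgebraK; letI := T.instFieldFbar; letI := T.instAlgebraFbar
  letI := T.instAlgebraKFbar; letI := T.instIsElliptic
  haveI h7 : Fact (Nat.Prime 7) := ⟨by norm_num⟩
  intro tq htq0 htq
  obtain ⟨x₀, hS, -, -, -, hnorm⟩ := GenuineK.exists_place_lamSeven hk hl h11 T
  have hspec := (exists_realising_qIdeles_pilotDataOfK T.D).choose_spec
  obtain ⟨P, hP, -, -⟩ := exists_nat_qPilot_pilotDataOfK T.D hS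
  -- the local type at `x₀`: `l ≤ e ∣ 60·l`
  have hdvd : absRamificationIdx 7 (kOf (pilotDataOfK T.D T.K) 7 x₀) ∣ 60 * l :=
    GenuineK.absRamificationIdx_kOf_dvd_sixty_mul hk hl h11 T x₀
  have hle : l ≤ absRamificationIdx 7 (kOf (pilotDataOfK T.D T.K) 7 x₀) :=
    l_le_absRamificationIdx_kOf_pilotDataOfK T.D ⟨7, by norm_num⟩ x₀ hS
  have he60 : absRamificationIdx 7 (kOf (pilotDataOfK T.D T.K) 7 x₀) ≤ 60 * l := Nat.le_of_dvd (by omega) hdvd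
  have he1 : 1 ≤ absRamificationIdx 7 (kOf (pilotDataOfK T.D T.K) 7 x₀) := absRamificationIdx_pos _ _
  have he0 : (0 : ℝ) < (absRamificationIdx 7 (kOf (pilotDataOfK T.D T.K) 7 x₀) : ℝ) := by exact_mod_cast he1
  -- `P·l = k·e` from the two expressions of `‖t_q(x₀)‖` for the CHOSEN realising q-idele
  have h1 : ‖(exists_realising_qIdeles_pilotDataOfK T.D).choose ⟨7, by norm_num⟩ x₀‖ =
      ((7 : ℕ) : ℝ) ^ (-((P : ℝ) / (absRamificationIdx 7 (kOf (pilotDataOfK T.D T.K) 7 x₀) : ℝ))) :=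
    norm_tq_eq_rpow T.D _ hspec.1 hspec.2.2 ⟨7, by norm_num⟩ x₀ hP
  rw [hnorm] at h1
  have hl0 : (l : ℝ) ≠ 0 := by exact_mod_cast hl.ne_zero
  have hPl : (P : ℝ) * l = k * (absRamificationIdx 7 (kOf (pilotDataOfK T.D T.K) 7 x₀) : ℝ) := by
    have h70 : (0 : ℝ) < 7 := by norm_num
    have hlog7 : Real.log 7 ≠ 0 := (Real.log_pos (by norm_num : (1 : ℝ) < 7)).ne'
    have hlog := congrArg Real.log h1
    rw [Nat.cast_ofNat, Real.log_rpow h70, Real.log_rpow h70] at hlog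
    have hq : (k : ℝ) / l = (P : ℝ) / (absRamificationIdx 7 (kOf (pilotDataOfK T.D T.K) 7 x₀) : ℝ) := by
      have := mul_right_cancel₀ hlog7 hlog
      linarith
    field_simp at hq
    linarith
  have hPl' : P * l = k * absRamificationIdx 7 (kOf (pilotDataOfK T.D T.K) 7 x₀) := by exact_mod_cast hPl
  -- row 9's NEG door at the label `3`, then `not_hStar_of_negDoor`
  have hdoor : NegDoor 7 (absRamificationIdx 7 (kOf (pilotDataOfK T.D T.K) 7 x₀)) P 3 :=
    negDoor_three_of_trigger (by omega) ((natLog_div_six_le_of_le_sixty_mul he60).trans hB) hkB hPl'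
  have hpe : (7 : ℕ) - 1 ≤ absRamificationIdx 7 (kOf (pilotDataOfK T.D T.K) 7 x₀) := by omega
  exact not_hStar_of_negDoor T.D tq htq0 htq (by omega) ⟨7, by norm_num⟩ x₀ hS hP hpe hdoor

/-- **THEOREM-GRADE KILL OF H⋆₉ ON THE HEX FAMILY, AT THE CHOSEN REALISING q-IDELE (MODEL-FREE)** — the corollary of
`not_hStar_lamSeven_of_realises` for THE q-idele of the `K`-level certificates (`Cor312Prov.exists_realising_qIdeles_pilotDataOfK`, [IUTchI]
Ex. 3.2 (iv)), i.e. the negation of the conclusion of p459152's `hStar_chosen_of_posDoor`. [cite: Mochizuki2012, IUTchI Ex. 3.2 (iv) p. 71;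
IUTchIV Cor. 2.2 (ii) proof (P5) p. 46] [claim: Mochizuki2012, status: disputed] -/
theorem not_hStar_lamSeven {k l B : ℕ} (hk : 1 ≤ k) (hl : l.Prime) (h11 : 11 ≤ l)
    (hB : Nat.log 7 (10 * l) ≤ B) (hkB : l * (B + 2) ≤ 8 * k)
    (T : Cor22.ThetaVolumeDatumAt (ratPoint ((2 : ℚ)⁻¹ + 2 / 7 ^ k)) l) :
    letI := T.instFieldF; letI := T.instNumberFieldF; letI := T.instAlgebraF; letI := T.instFieldK
    letI := T.instNumberFieldK; letI := T.instAlgebraK; letI := T.instFieldFbar; letI := T.instAlgebraFbar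
    letI := T.instAlgebraKFbar; letI := T.instIsElliptic
    ¬ HStar T.D (exists_realising_qIdeles_pilotDataOfK T.D).choose := by
  letI := T.instFieldF; letI := T.instNumberFieldF; letI := T.instAlgebraF; letI := T.instFieldK
  letI := T.instNumberFieldK; letI := T.instAlgebraK; letI := T.instFieldFbar; letI := T.instAlgebraFbar
  letI := T.instAlgebraKFbar; letI := T.instIsElliptic
  exact not_hStar_lamSeven_of_realises hk hl h11 hB hkB T _ (exists_realising_qIdeles_pilotDataOfK T.D).choose_spec.1
    (exists_realising_qIdeles_pilotDataOfK T.D).choose_spec.2.2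

/-! ## §3. Numeric rows -/

/-- **`l = 11`, model-free: `¬ H⋆₉` at every `λ_k` datum with `k ≥ 6`** (`B = 2`: `10·11 = 110 < 7³`; `11·4 = 44 ≤ 8·k` iff `k ≥ 6`).
[claim: Mochizuki2012, status: disputed] -/
theorem not_hStar_lamSeven_l11 {k : ℕ} (hk : 6 ≤ k) (T : Cor22.ThetaVolumeDatumAt (ratPoint ((2 : ℚ)⁻¹ + 2 / 7 ^ k)) 11) :
    letI := T.instFieldF; letI := T.instNumberFieldF; letI := T.instAlgebraF; letI := T.instFieldK
    letI := T.instNumberFieldK; letI := T.instAlgebraK; letI := T.instFieldFbar; letI := T.instAlgebraFbar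
    letI := T.instAlgebraKFbar; letI := T.instIsElliptic
    ¬ HStar T.D (exists_realising_qIdeles_pilotDataOfK T.D).choose :=
  not_hStar_lamSeven (B := 2) (by omega) (by norm_num) le_rfl (natLog_ten_mul_le_two (by norm_num)) (by omega) T

/-- **`l = 13`, model-free: `¬ H⋆₉` at every `λ_k` datum with `k ≥ 7`** (`B = 2`: `10·13 = 130 < 7³`; `13·4 = 52 ≤ 8·k` iff `k ≥ 7`).
[claim: Mochizuki2012, status: disputed] -/
theorem not_hStar_lamSeven_l13 {k : ℕ} (hk : 7 ≤ k) (T : Cor22.ThetaVolumeDatumAt (ratPoint ((2 : ℚ)⁻¹ + 2 / 7 ^ k)) 13) :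
    letI := T.instFieldF; letI := T.instNumberFieldF; letI := T.instAlgebraF; letI := T.instFieldK
    letI := T.instNumberFieldK; letI := T.instAlgebraK; letI := T.instFieldFbar; letI := T.instAlgebraFbar
    letI := T.instAlgebraKFbar; letI := T.instIsElliptic
    ¬ HStar T.D (exists_realising_qIdeles_pilotDataOfK T.D).choose :=
  not_hStar_lamSeven (B := 2) (by omega) (by norm_num) (by norm_num) (natLog_ten_mul_le_two (by norm_num)) (by omega) T

/-- **THE UNIFORM STRIP `11 ≤ l ≤ 34`** (`l` prime; `B = 2` since `10·l ≤ 340 < 7³`): `¬ H⋆₉` at every `λ_k` datum with `l ≤ 2·k`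
(trigger `4·l ≤ 8·k`) — `l = 11: k ≥ 6`, `13: k ≥ 7`, `17: k ≥ 9`, `19: k ≥ 10`, `23: k ≥ 12`, `29: k ≥ 15`, `31: k ≥ 16`.
[claim: Mochizuki2012, status: disputed] -/
theorem not_hStar_lamSeven_of_le_34 {k l : ℕ} (hl : l.Prime) (h11 : 11 ≤ l) (h34 : l ≤ 34) (hkl : l ≤ 2 * k)
    (T : Cor22.ThetaVolumeDatumAt (ratPoint ((2 : ℚ)⁻¹ + 2 / 7 ^ k)) l) :
    letI := T.instFieldF; letI := T.instNumberFieldF; letI := T.instAlgebraF; letI := T.instFieldK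
    letI := T.instNumberFieldK; letI := T.instAlgebraK; letI := T.instFieldFbar; letI := T.instAlgebraFbar
    letI := T.instAlgebraKFbar; letI := T.instIsElliptic
    ¬ HStar T.D (exists_realising_qIdeles_pilotDataOfK T.D).choose :=
  not_hStar_lamSeven (B := 2) (by omega) hl h11 (natLog_ten_mul_le_two h34) (by omega) T

/-! ## §4. Per fibre point, with a supplied small ramification index (a HYPOTHESIS on the place, never asserted) -/

/-- **`¬ H⋆₉` FROM ONE FIBRE POINT WITH `e(K_{x₀}/ℚ_7) ≤ 41`** (the table's lamSeven rows with `e_w = l`, i.e. `e(v|7) = 1`; then `b_e = 0`):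
`k ≥ 1`, `l` prime `≥ 7`, `l ≤ 4·k`; if at some `x₀ | 7` the chosen realising q-idele has `‖t_q(x₀)‖ = 7^{−k/l}` and `e(K_{x₀}/ℚ_7) ≤ 41`, then
`¬ HStar T.D t_q` for that q-idele (`x₀` is automatically bad: off the bad set `‖t_q‖ = 1`, while `7^{−k/l} < 1`; the door `2·e + P ≤ 9·P` is
`l ≤ 4k` since `P·l = k·e`). The ramification bound is an INPUT on the place (cf. R-W's flagged local-model assumption A1), never asserted.
Thresholds: `k ≥ 3` at `l = 11`, `k ≥ 4` at `l = 13` (p459152 `k1_hex_large_k`: `¬ NegDoor 7 13 3 3`).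
[cite: Mochizuki2012, IUTchI Def. 3.1 (b),(c) pp. 61–62, Ex. 3.2 (iv) p. 71] [claim: Mochizuki2012, status: disputed] -/
theorem not_hStar_of_ramification_le_fortyone {k l : ℕ} (hk : 1 ≤ k) (hl : l.Prime) (h7 : 7 ≤ l) (hkl : l ≤ 4 * k)
    (T : Cor22.ThetaVolumeDatumAt (ratPoint ((2 : ℚ)⁻¹ + 2 / 7 ^ k)) l) :
    letI := T.instFieldF; letI := T.instNumberFieldF; letI := T.instAlgebraF; letI := T.instFieldK
    letI := T.instNumberFieldK; letI := T.instAlgebraK; letI := T.instFieldFbar; letI := T.instAlgebraFbar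
    letI := T.instAlgebraKFbar; letI := T.instIsElliptic
    haveI : Fact (Nat.Prime 7) := ⟨by norm_num⟩
    ∀ x₀ : (thetaIndex (pilotDataOfK T.D T.K)).Fibre (.inr ⟨7, by norm_num⟩),
      ‖(exists_realising_qIdeles_pilotDataOfK T.D).choose ⟨7, by norm_num⟩ x₀‖ = (7 : ℝ) ^ (-((k : ℝ) / l)) →
      absRamificationIdx 7 (kOf (pilotDataOfK T.D T.K) 7 x₀) ≤ 41 →
      ¬ HStar T.D (exists_realising_qIdeles_pilotDataOfK T.D).choose := by
  letI := T.instFieldF; letI := T.instNumberFieldF; letI := T.instAlgebraF; letI := T.instFieldK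
  letI := T.instNumberFieldK; letI := T.instAlgebraK; letI := T.instFieldFbar; letI := T.instAlgebraFbar
  letI := T.instAlgebraKFbar; letI := T.instIsElliptic
  haveI h7f : Fact (Nat.Prime 7) := ⟨by norm_num⟩
  intro x₀ hnorm h41
  have hspec := (exists_realising_qIdeles_pilotDataOfK T.D).choose_spec
  -- `x₀` is bad: off the bad set the realising q-idele is a unit, but `7^{−k/l} < 1`
  have hS : placeOf (pilotDataOfK T.D T.K) 7 x₀ ∈ (pilotDataOfK T.D T.K).S := by
    by_contra hnot
    have h1 := hspec.2.1 ⟨7, by norm_num⟩ x₀ hnot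
    have hl0 : (0 : ℝ) < l := by exact_mod_cast hl.pos
    have hk0 : (0 : ℝ) < k := by exact_mod_cast hk
    have hneg : -((k : ℝ) / l) < 0 := by
      have : (0 : ℝ) < (k : ℝ) / l := div_pos hk0 hl0
      linarith
    have hlt : (7 : ℝ) ^ (-((k : ℝ) / l)) < 1 := Real.rpow_lt_one_of_one_lt_of_neg (by norm_num) hneg
    have h1' : ‖(exists_realising_qIdeles_pilotDataOfK T.D).choose ⟨7, by norm_num⟩ x₀‖ = 1 := h1
    rw [hnorm] at h1'
    linarith
  obtain ⟨P, hP, -, -⟩ := exists_nat_qPilot_pilotDataOfK T.D hS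
  have hle : l ≤ absRamificationIdx 7 (kOf (pilotDataOfK T.D T.K) 7 x₀) :=
    l_le_absRamificationIdx_kOf_pilotDataOfK T.D ⟨7, by norm_num⟩ x₀ hS
  have he1 : 1 ≤ absRamificationIdx 7 (kOf (pilotDataOfK T.D T.K) 7 x₀) := absRamificationIdx_pos _ _
  have he0 : (0 : ℝ) < (absRamificationIdx 7 (kOf (pilotDataOfK T.D T.K) 7 x₀) : ℝ) := by exact_mod_cast he1
  have h1 : ‖(exists_realising_qIdeles_pilotDataOfK T.D).choose ⟨7, by norm_num⟩ x₀‖ =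
      ((7 : ℕ) : ℝ) ^ (-((P : ℝ) / (absRamificationIdx 7 (kOf (pilotDataOfK T.D T.K) 7 x₀) : ℝ))) :=
    norm_tq_eq_rpow T.D _ hspec.1 hspec.2.2 ⟨7, by norm_num⟩ x₀ hP
  rw [hnorm] at h1
  have hl0 : (l : ℝ) ≠ 0 := by exact_mod_cast hl.ne_zero
  have hPl : (P : ℝ) * l = k * (absRamificationIdx 7 (kOf (pilotDataOfK T.D T.K) 7 x₀) : ℝ) := by
    have h70 : (0 : ℝ) < 7 := by norm_num
    have hlog7 : Real.log 7 ≠ 0 := (Real.log_pos (by norm_num : (1 : ℝ) < 7)).ne'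
    have hlog := congrArg Real.log h1
    rw [Nat.cast_ofNat, Real.log_rpow h70, Real.log_rpow h70] at hlog
    have hq : (k : ℝ) / l = (P : ℝ) / (absRamificationIdx 7 (kOf (pilotDataOfK T.D T.K) 7 x₀) : ℝ) := by
      have := mul_right_cancel₀ hlog7 hlog
      linarith
    field_simp at hq
    linarith
  have hPl' : P * l = k * absRamificationIdx 7 (kOf (pilotDataOfK T.D T.K) 7 x₀) := by exact_mod_cast hPl
  -- `b_e = 0` for `e ≤ 41` (`e/6 ≤ 6 < 7`), trigger `l·2 ≤ 8k`
  have hB : Nat.log 7 (absRamificationIdx 7 (kOf (pilotDataOfK T.D T.K) 7 x₀) / 6) ≤ 0 := by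
    have h71 : absRamificationIdx 7 (kOf (pilotDataOfK T.D T.K) 7 x₀) / 6 < 7 ^ 1 := by rw [pow_one]; omega
    have : Nat.log 7 (absRamificationIdx 7 (kOf (pilotDataOfK T.D T.K) 7 x₀) / 6) < 1 :=
      Nat.log_lt_of_lt_pow (by omega) h71
    omega
  have hdoor : NegDoor 7 (absRamificationIdx 7 (kOf (pilotDataOfK T.D T.K) 7 x₀)) P 3 :=
    negDoor_three_of_trigger (B := 0) (by omega) hB (by omega) hPl'
  have hpe : (7 : ℕ) - 1 ≤ absRamificationIdx 7 (kOf (pilotDataOfK T.D T.K) 7 x₀) := by omega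
  exact not_hStar_of_negDoor T.D _ hspec.1 hspec.2.2 h7 ⟨7, by norm_num⟩ x₀ hS hP hpe hdoor

/-- The §4 rows: `l ≤ 4k` at `l = 11` iff `k ≥ 3`; at `l = 13` iff `k ≥ 4`; and the integer doors there (p459152 vocabulary). -/
example : ¬ (11 ≤ 4 * 2) ∧ (11 ≤ 4 * 3) ∧ ¬ (13 ≤ 4 * 3) ∧ (13 ≤ 4 * 4) ∧ NegDoor 7 11 3 3 ∧ ¬ NegDoor 7 13 3 3 ∧ NegDoor 7 13 4 3 := by
  unfold NegDoor
  decide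

end Summit.ABC.IUTFork.Repair.RH.LabelCutJ3

end
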